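import Summits.QuantumFields.YangMills.Theorems.UnitScaleTiltProp7LapCombSites
import Summits.QuantumFields.YangMills.Theorems.UnitScaleTiltProp7AxialLocalModel
import HarnessLib

/-!
# Route `UnitScaleTilt`, crux K1 «MinimiserStabilityRegPr» (stmt-QuantumFields-19200), route-R E′, S3 K-form engine, ROW (H) — hLap INHABITANT, FILE H₁ (torus letters):
# THE COVARIANT LAPLACIAN OF THE AXIAL (COMB) LOCAL MODEL ON THE TORUS, SITE-CURRENT FORM — ✓ `Prop7AxialLocalModel.lap_axialModel` (exact, two (27)-contours per direction)
# read through the periodic pull-back (✓ `Prop7CombLadder.holT_contourT_eq_hol_pull`) and fed to ✓ `Prop7LapCombSites.norm_lapSum_comb_le_sites`: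
# `‖Δ_VΨ(x)‖ ≤ Σ_(sites of Γ(0, x−c)) N_m(Σ_(μ before the site's run) 𝒯(p)(P − V⁻¹P′V)𝒯(p)⁻¹) + 15a·Σ_μ|B_μ|·(FAM integrands)` for `Ψ = R(axialT V c ·)⁻¹ m`

Cell `ym3-torus`, width seat `ym3-torus-px4` (gen 4); ★ym-ust-19200-p1 g16 NAMER WORD 14 «px4 g4: hLap INHABITANT GO» (2026-08-29 00:17Z), road (iii).  THEOREMS ONLY (0 `def`,
0 `sorry`); `--supports stmt-QuantumFields-19200`, count-neutral.  YM₃ on T³ is a ladder rung (R3), not the Clay problem; nothing here claims hLap, hRes, (H), S3, E′, a stub,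
the crux, d = 4 or the mass gap.

WHAT IS PROVED (ns `…Theorems.Prop7LapTorusSites`; torus `Site P j`, `V : GaugeField P j 𝔸ˣ` bi-contractive, centre `c`, site `x`, splits `hsplit`).
* `rel_unshift_eq` (`rel c (x − e_μ) = rel c x − e_μ` under the no-wrap window of ✓ `lap_axialModel`).
* ★★★ `norm_lap_axialModel_le_sites` — the title bound (one decl-local `maxHeartbeats 400000`, README budget rule); windows displayed: no wrap-around at `⟨x,μ⟩`, `⟨x−e_μ,μ⟩`,
  pulled-back plaquette words within `a`, `a·|B_μ(rel c x)| ≤ 1`.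
HONEST SCOPE.  Torus dictionary over landed files; the offset family, the `Σ_h` telescoping of the middle-run terms, the supported sums over `z ∈ N(y)` and the counts
(✓ `Prop7LapCombSitesCount`) are the next file(s).

References: T. Bałaban, CMP 102 (1985) 255–275 [Balaban1985UV3] ((27) p.263); CMP 99 (1985) 389–434 [Balaban1985BackgroundPropagators] ((3.3)–(3.4) pp.390–391, (3.8) p.392);
CMP 98 (1985) 17–51 [Balaban1985Averaging] ((9) pp.18–19, (19)–(20) p.21, p.24); CMP 99 (1985) 75–102 [Balaban1985RegularSpaces] ((1.1)–(1.2) p.76, (1.9) p.77).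
-/

set_option autoImplicit false

noncomputable section

open scoped BigOperators

namespace Summit.QuantumFields.YangMills.Theorems.Prop7LapTorusSites

open Literature.MathematicalPhysics.QuantumFieldTheory.Balaban1983to89
open B7Prop1Explicit (Letter e disp revWord seg treeWord hol)
open B10Eq27AxialLog (contour27)
open B9Eq39Adjoint (R R_def covD divB)
open B9TorusCalculus (torusT torusT_symm_apply)
open B10Eq27TorusAxialLog (holT axialT contourT rel pull rel_shift_of_le)
open Summit.QuantumFields.YangMills.Theorems.Prop7AxialLocalModel (lap_axialModel bicontr_holT)
open Summit.QuantumFields.YangMills.Theorems.Prop7CombLadder (holT_contourT_eq_hol_pull bicontr_pull)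
open Summit.QuantumFields.YangMills.Theorems.Prop7LapCombSites (norm_lapSum_comb_le_sites)
open B16Txt357ThirdOrderNonAbelian (norm_R_le)

variable {P : Params} {j : ℕ}

/-- no wrap-around backwards: `rel c (x − e_μ) = rel c x − e_μ` as soon as `(rel c (x−e_μ) μ + 1)·2 ≤ N` (✓ `rel_shift_of_le` at `x − e_μ`). [cite: Balaban1985UV3, (27) p.263] -/
theorem rel_unshift_eq (c x : Site P j) (μ : Fin P.d) (hx' : (rel c ((torusT P j μ).symm x) μ + 1) * 2 ≤ (P.sitesPerDir j : ℤ)) :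
    rel c ((torusT P j μ).symm x) = rel c x - e μ := by
  have h := rel_shift_of_le c ((torusT P j μ).symm x) μ hx'
  rw [torusT_symm_apply, B10StarCount.shift_unshift] at h
  rw [torusT_symm_apply, h, add_sub_cancel_right]

variable {𝔸 : Type*} [NormedRing 𝔸] [NormOneClass 𝔸] (V : GaugeField P j 𝔸ˣ)
  (hV : ∀ b : PBond P j, ‖(V b : 𝔸)‖ ≤ 1 ∧ ‖(((V b)⁻¹ : 𝔸ˣ) : 𝔸)‖ ≤ 1)
  (s t : Fin P.d → List (Fin P.d)) (hsplit : ∀ μ, (List.finRange P.d).reverse = s μ ++ μ :: t μ)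

include hV hsplit in
set_option maxHeartbeats 400000 in
/-- ★★★ **THE COVARIANT LAPLACIAN OF THE AXIAL LOCAL MODEL ON THE TORUS, SITE-CURRENT FORM.**  For `Ψ = R(axialT V c ·)⁻¹ m`, with no wrap-around at `⟨x,μ⟩` and `⟨x−e_μ,μ⟩`
(all `μ`), pulled-back plaquette words within `a ≥ 0` of `1` and `a·|B_μ(rel c x)| ≤ 1`:
`‖Δ_VΨ(x)‖ ≤ Σ_κ Σ_(j<|(x−c)_κ|) N_m(Σ_(μ∈s κ) 𝒯(p_(κ,j))·(P(p_(κ,j),μ) − V(p−e_μ,μ)⁻¹P(p−e_μ,μ)V(p−e_μ,μ))·𝒯(p_(κ,j))⁻¹) + Σ_μ 15a|B_μ|(ΣN₁^μ + ΣN₂^μ)` in the letters of the pull-back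
`pull V c` (site currents along the comb `Γ(0, x−c)`; canonical rung families at `x − c` and `x − c − e_μ`).
[cite: Balaban1985UV3, (27) p.263; Balaban1985BackgroundPropagators, (3.3)-(3.4) pp.390-391, (3.8) p.392; Balaban1985Averaging, (9) pp.18-19, p.24; Balaban1985RegularSpaces, (1.1)-(1.2) p.76, (1.9) p.77] -/
theorem norm_lap_axialModel_le_sites (c : Site P j) (m : 𝔸) (x : Site P j) (dflt : Letter P.d) {a : ℝ} (ha : 0 ≤ a)
    (hx : ∀ μ : Fin P.d, (rel c x μ + 1) * 2 ≤ (P.sitesPerDir j : ℤ))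
    (hx' : ∀ μ : Fin P.d, (rel c ((torusT P j μ).symm x) μ + 1) * 2 ≤ (P.sitesPerDir j : ℤ))
    (hplaq : ∀ (μ : Fin P.d) (z : B7Prop1Explicit.Site P.d) (l : Letter P.d), ‖((hol (B10Eq27TorusAxialLog.pull V c) z [l, (μ, true), l.rev, (μ, false)] : 𝔸ˣ) : 𝔸) - 1‖ ≤ a)
    (han : ∀ μ : Fin P.d, a * ((t μ).flatMap (fun κ => seg κ ((B10Eq27TorusAxialLog.rel c x) κ))).length ≤ 1) :
    ‖divB (torusT P j) (fun κ z => V ⟨z, κ⟩) (fun μ => covD (torusT P j) (fun κ z => V ⟨z, κ⟩) μ (fun z => R (axialT V c z)⁻¹ m)) x‖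
      ≤ ∑ κ : Fin P.d, ∑ j ∈ Finset.range ((B10Eq27TorusAxialLog.rel c x) κ).natAbs,
            ‖(∑ μ ∈ (s κ).toFinset, ((hol (B10Eq27TorusAxialLog.pull V c) 0 (treeWord (disp ((s κ).flatMap (fun ν => seg ν ((B10Eq27TorusAxialLog.rel c x) ν))) + disp ((seg κ ((B10Eq27TorusAxialLog.rel c x) κ)).take j))) : 𝔸ˣ) : 𝔸) * (((hol (B10Eq27TorusAxialLog.pull V c) (disp ((s κ).flatMap (fun ν => seg ν ((B10Eq27TorusAxialLog.rel c x) ν))) + disp ((seg κ ((B10Eq27TorusAxialLog.rel c x) κ)).take j)) [(seg κ ((B10Eq27TorusAxialLog.rel c x) κ)).getD j dflt, (μ, true), ((seg κ ((B10Eq27TorusAxialLog.rel c x) κ)).getD j dflt).rev, (μ, false)] : 𝔸ˣ) : 𝔸) - (((((B10Eq27TorusAxialLog.pull V c) ((disp ((s κ).flatMap (fun ν => seg ν ((B10Eq27TorusAxialLog.rel c x) ν))) + disp ((seg κ ((B10Eq27TorusAxialLog.rel c x) κ)).take j)) - e μ) μ)⁻¹ * hol (B10Eq27TorusAxialLog.pull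 V c) ((disp ((s κ).flatMap (fun ν => seg ν ((B10Eq27TorusAxialLog.rel c x) ν))) + disp ((seg κ ((B10Eq27TorusAxialLog.rel c x) κ)).take j)) - e μ) [(seg κ ((B10Eq27TorusAxialLog.rel c x) κ)).getD j dflt, (μ, true), ((seg κ ((B10Eq27TorusAxialLog.rel c x) κ)).getD j dflt).rev, (μ, false)] * (((B10Eq27TorusAxialLog.pull V c) ((disp ((s κ).flatMap (fun ν => seg ν ((B10Eq27TorusAxialLog.rel c x) ν))) + disp ((seg κ ((B10Eq27TorusAxialLog.rel c x) κ)).take j)) - e μ) μ)⁻¹)⁻¹ : 𝔸ˣ) : 𝔸))) * (((hol (B10Eq27TorusAxialLog.pull V c) 0 (treeWord (disp ((s κ).flatMap (fun ν => seg ν ((B10Eq27TorusAxialLog.rel c x) ν))) + disp ((seg κ ((B10Eq27TorusAxialLog.rel c x) κ)).take j))))⁻¹ : 𝔸ˣ) : 𝔸)) * m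
              - m * ∑ μ ∈ (s κ).toFinset, ((hol (B10Eq27TorusAxialLog.pull V c) 0 (treeWord (disp ((s κ).flatMap (fun ν => seg ν ((B10Eq27TorusAxialLog.rel c x) ν))) + disp ((seg κ ((B10Eq27TorusAxialLog.rel c x) κ)).take j))) : 𝔸ˣ) : 𝔸) * (((hol (B10Eq27TorusAxialLog.pull V c) (disp ((s κ).flatMap (fun ν => seg ν ((B10Eq27TorusAxialLog.rel c x) ν))) + disp ((seg κ ((B10Eq27TorusAxialLog.rel c x) κ)).take j)) [(seg κ ((B10Eq27TorusAxialLog.rel c x) κ)).getD j dflt, (μ, true), ((seg κ ((B10Eq27TorusAxialLog.rel c x) κ)).getD j dflt).rev, (μ, false)] : 𝔸ˣ) : 𝔸) - (((((B10Eq27TorusAxialLog.pull V c) ((disp ((s κ).flatMap (fun ν => seg ν ((B10Eq27TorusAxialLog.rel c x) ν))) + disp ((seg κ ((B10Eq27TorusAxialLog.rel c x) κ)).take j)) - e μ) μ)⁻¹ * hol (B10Eq27TorusAxialLog.pull V c) ((disp ((s κ).flatMap (fun ν => seg ν ((B10Eq27TorusAxialLog.rel c x) ν))) + disp ((seg κ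 ((B10Eq27TorusAxialLog.rel c x) κ)).take j)) - e μ) [(seg κ ((B10Eq27TorusAxialLog.rel c x) κ)).getD j dflt, (μ, true), ((seg κ ((B10Eq27TorusAxialLog.rel c x) κ)).getD j dflt).rev, (μ, false)] * (((B10Eq27TorusAxialLog.pull V c) ((disp ((s κ).flatMap (fun ν => seg ν ((B10Eq27TorusAxialLog.rel c x) ν))) + disp ((seg κ ((B10Eq27TorusAxialLog.rel c x) κ)).take j)) - e μ) μ)⁻¹)⁻¹ : 𝔸ˣ) : 𝔸))) * (((hol (B10Eq27TorusAxialLog.pull V c) 0 (treeWord (disp ((s κ).flatMap (fun ν => seg ν ((B10Eq27TorusAxialLog.rel c x) ν))) + disp ((seg κ ((B10Eq27TorusAxialLog.rel c x) κ)).take j))))⁻¹ : 𝔸ˣ) : 𝔸)‖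
        + ∑ μ : Fin P.d, 15 * a * ((t μ).flatMap (fun κ => seg κ ((B10Eq27TorusAxialLog.rel c x) κ))).length
            * (∑ k ∈ Finset.range ((t μ).flatMap (fun κ => seg κ ((B10Eq27TorusAxialLog.rel c x) κ))).length, ‖((hol (B10Eq27TorusAxialLog.pull V c) (disp ((s μ).flatMap (fun κ => seg κ ((B10Eq27TorusAxialLog.rel c x) κ)) ++ seg μ ((B10Eq27TorusAxialLog.rel c x) μ)) + disp (((t μ).flatMap (fun κ => seg κ ((B10Eq27TorusAxialLog.rel c x) κ))).take k)) [((t μ).flatMap (fun κ => seg κ ((B10Eq27TorusAxialLog.rel c x) κ))).getD k (μ, true), (μ, true), (((t μ).flatMap (fun κ => seg κ ((B10Eq27TorusAxialLog.rel c x) κ))).getD k (μ, true)).rev, (μ, false)] : 𝔸ˣ) : 𝔸) * R (hol (B10Eq27TorusAxialLog.pull V c) 0 (treeWord (disp ((s μ).flatMap (fun κ => seg κ ((B10Eq27TorusAxialLog.rel c x) κ)) ++ seg μ ((B10Eq27TorusAxialLog.rel c x) μ)) + disp (((t μ).flatMap (fun κ => seg κ ((B10Eq27TorusAxialLog.rel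 c x) κ))).take k))))⁻¹ m - R (hol (B10Eq27TorusAxialLog.pull V c) 0 (treeWord (disp ((s μ).flatMap (fun κ => seg κ ((B10Eq27TorusAxialLog.rel c x) κ)) ++ seg μ ((B10Eq27TorusAxialLog.rel c x) μ)) + disp (((t μ).flatMap (fun κ => seg κ ((B10Eq27TorusAxialLog.rel c x) κ))).take k))))⁻¹ m * ((hol (B10Eq27TorusAxialLog.pull V c) (disp ((s μ).flatMap (fun κ => seg κ ((B10Eq27TorusAxialLog.rel c x) κ)) ++ seg μ ((B10Eq27TorusAxialLog.rel c x) μ)) + disp (((t μ).flatMap (fun κ => seg κ ((B10Eq27TorusAxialLog.rel c x) κ))).take k)) [((t μ).flatMap (fun κ => seg κ ((B10Eq27TorusAxialLog.rel c x) κ))).getD k (μ, true), (μ, true), (((t μ).flatMap (fun κ => seg κ ((B10Eq27TorusAxialLog.rel c x) κ))).getD k (μ, true)).rev, (μ, false)] : 𝔸ˣ) : 𝔸)‖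
              + ∑ k ∈ Finset.range ((t μ).flatMap (fun κ => seg κ ((B10Eq27TorusAxialLog.rel c x) κ))).length, ‖((hol (B10Eq27TorusAxialLog.pull V c) ((disp ((s μ).flatMap (fun κ => seg κ ((B10Eq27TorusAxialLog.rel c x) κ)) ++ seg μ ((B10Eq27TorusAxialLog.rel c x) μ)) + disp (((t μ).flatMap (fun κ => seg κ ((B10Eq27TorusAxialLog.rel c x) κ))).take k)) - e μ) [((t μ).flatMap (fun κ => seg κ ((B10Eq27TorusAxialLog.rel c x) κ))).getD k (μ, true), (μ, true), (((t μ).flatMap (fun κ => seg κ ((B10Eq27TorusAxialLog.rel c x) κ))).getD k (μ, true)).rev, (μ, false)] : 𝔸ˣ) : 𝔸) * R (hol (B10Eq27TorusAxialLog.pull V c) 0 (treeWord ((disp ((s μ).flatMap (fun κ => seg κ ((B10Eq27TorusAxialLog.rel c x) κ)) ++ seg μ ((B10Eq27TorusAxialLog.rel c x) μ)) + disp (((t μ).flatMap (fun κ => seg κ ((B10Eq27TorusAxialLog.rel c x) κ))).take k)) - e μ)))⁻¹ m - R (hol (B10Eq27TorusAxialLog.pull V c) 0 (treeWord ((disp ((s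 μ).flatMap (fun κ => seg κ ((B10Eq27TorusAxialLog.rel c x) κ)) ++ seg μ ((B10Eq27TorusAxialLog.rel c x) μ)) + disp (((t μ).flatMap (fun κ => seg κ ((B10Eq27TorusAxialLog.rel c x) κ))).take k)) - e μ)))⁻¹ m * ((hol (B10Eq27TorusAxialLog.pull V c) ((disp ((s μ).flatMap (fun κ => seg κ ((B10Eq27TorusAxialLog.rel c x) κ)) ++ seg μ ((B10Eq27TorusAxialLog.rel c x) μ)) + disp (((t μ).flatMap (fun κ => seg κ ((B10Eq27TorusAxialLog.rel c x) κ))).take k)) - e μ) [((t μ).flatMap (fun κ => seg κ ((B10Eq27TorusAxialLog.rel c x) κ))).getD k (μ, true), (μ, true), (((t μ).flatMap (fun κ => seg κ ((B10Eq27TorusAxialLog.rel c x) κ))).getD k (μ, true)).rev, (μ, false)] : 𝔸ˣ) : 𝔸)‖) := by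
  rw [lap_axialModel V c m x hx hx']
  have hA := bicontr_holT V hV c (treeWord (rel c x))
  have hAinv : ‖(((axialT V c x)⁻¹ : 𝔸ˣ) : 𝔸)‖ ≤ 1 ∧ ‖((((axialT V c x)⁻¹)⁻¹ : 𝔸ˣ) : 𝔸)‖ ≤ 1 := by rw [inv_inv]; exact ⟨hA.2, hA.1⟩
  refine (norm_R_le hAinv _).trans ?_
  -- the two contours through the pull-back, the backward one at `rel c x − e_μ`
  have hsum : (∑ μ : Fin P.d, ((2 : ℕ) • m - R (holT V c (contourT c ⟨(torusT P j μ).symm x, μ⟩))⁻¹ m - R (holT V c (contourT c ⟨x, μ⟩)) m))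
      = ∑ μ : Fin P.d, ((2 : ℕ) • m - R (hol (B10Eq27TorusAxialLog.pull V c) 0 (contour27 0 (rel c x - e μ) μ))⁻¹ m - R (hol (B10Eq27TorusAxialLog.pull V c) 0 (contour27 0 (rel c x) μ)) m) :=
    Finset.sum_congr rfl fun μ _ => by
      rw [holT_contourT_eq_hol_pull, holT_contourT_eq_hol_pull]
      simp only [rel_unshift_eq c x μ (hx' μ)]
  rw [hsum]
  have hVp : ∀ (z : B7Prop1Explicit.Site P.d) (κ : Fin P.d), ‖(((B10Eq27TorusAxialLog.pull V c) z κ : 𝔸ˣ) : 𝔸)‖ ≤ 1 ∧ ‖(((((B10Eq27TorusAxialLog.pull V c) z κ)⁻¹ : 𝔸ˣ) : 𝔸))‖ ≤ 1 :=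
    bicontr_pull V hV c
  exact norm_lapSum_comb_le_sites (B10Eq27TorusAxialLog.pull V c) hVp s t hsplit dflt (rel c x) m ha hplaq han

end Summit.QuantumFields.YangMills.Theorems.Prop7LapTorusSites

end
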